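import Mathlib
import Literature.Analysis.Complex.CauchyTransformHolderExtension
import Literature.Geometry.Symplectic.JHolomorphicRegularityHolderAux
import Literature.Geometry.Symplectic.JHolomorphicRegularityHolderCutoff
import HarnessLib

/-!
# Elliptic bootstrapping for `J`-holomorphic curves in Hölder classes: the linear estimate

The a priori `C^{1,r}` estimate for solutions of a linear Cauchy–Riemann type system
`∂ₓ v + A(z) ∂_y v = f` on a disc `B(z₀, ρ) ⊆ ℂ` with values in `ℝ⁴`, where the coefficients
`A(z)` are linear complex structures CONJUGATE TO THE STANDARD ONE by a `C^{1,r}` frame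
`Θ(z) : ℂ² → ℝ⁴` (`A(z) Θ(z) = Θ(z) ∘ i` on the disc): on the disc of half the radius,
`‖Dv‖` and the `r`-Hölder constant of `Dv` are bounded by `K (‖v‖_{C^{0,r}} + ‖f‖_{C^{0,r}})`
with `K` depending only on the frame, the coefficients, the disc and the constant of the
`C^{1,r}` estimate for the Cauchy transform (`Literature.Analysis.Complex.CauchyTransformHolderApriori`,
taken as a hypothesis). This is the engine of the Hölder version of elliptic bootstrapping for
`J`-holomorphic curves (McDuff–Salamon 2012, Thm. B.4.1), applied there to difference quotients.

Proof (`holder_fderiv_of_linearCR`): in the frame, `ṽ = Θ⁻¹ v` satisfies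
`2 ∂̄ ṽ = Θ⁻¹ (f - (∂ₓΘ) ṽ - A (∂_yΘ) ṽ)`; for a cutoff `η` (`= 1` on the half disc) the compactly
supported `C¹` map `η ṽ` IS the Cauchy transform of `∂̄ (η ṽ) = η ∂̄ ṽ + (∂̄ η) ṽ`
(Cauchy–Pompeiu, `cauchyTransformAlong_dbarAlong_self`), a `C^{0,r}` density supported in a disc
whose sup and Hölder constants are linear in those of `v` and `f`; the Cauchy transform estimate
(`cauchyTransform_holder_of_apriori`) bounds `D(η ṽ)` in `C^{0,r}`, and `Dv = Θ Dṽ + (DΘ) ṽ`.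

## References

* D. McDuff, D. Salamon, *J-holomorphic curves and symplectic topology*, 2nd ed. (2012),
  App. B.4, Thm. B.4.1. [McDuffSalamon2012]
* I. N. Vekua, *Generalized Analytic Functions* (1962), Ch. I, Thm. 1.32.
-/

noncomputable section

open Set Metric Filter Function Complex
open scoped Topology NNReal ContDiff

namespace Literature.Geometry.Symplectic

open Literature.Analysis.Complex Literature.Analysis.FunctionSpaces

/-- Local notation for the model space `ℝ⁴`. -/
local notation "E4" => EuclideanSpace ℝ (Fin 4)

section Smul

variable {W : Type*} [NormedAddCommGroup W] [NormedSpace ℝ W]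

/-- Sup and Hölder bounds for `z ↦ η z • w z` with a real scalar factor. [folklore] -/
theorem holder_bound_smul {η : ℂ → ℝ} {w : ℂ → W} {p₀ p₁ q₀ q₁ s : ℝ}
    (hp₀ : ∀ z, ‖η z‖ ≤ p₀) (hp₁ : ∀ z z', ‖η z - η z'‖ ≤ p₁ * ‖z - z'‖ ^ s)
    (hq₀ : ∀ z, ‖w z‖ ≤ q₀) (hq₁ : ∀ z z', ‖w z - w z'‖ ≤ q₁ * ‖z - z'‖ ^ s) :
    (∀ z, ‖η z • w z‖ ≤ p₀ * q₀) ∧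
      ∀ z z', ‖η z • w z - η z' • w z'‖ ≤ (p₁ * q₀ + p₀ * q₁) * ‖z - z'‖ ^ s := by
  have hp : 0 ≤ p₀ := (norm_nonneg _).trans (hp₀ 0)
  refine ⟨fun z => ?_, fun z z' => ?_⟩
  · rw [norm_smul]
    exact mul_le_mul (hp₀ z) (hq₀ z) (norm_nonneg _) hp
  · have e : η z • w z - η z' • w z' = (η z - η z') • w z + η z' • (w z - w z') := by
      rw [sub_smul, smul_sub]
      abel
    rw [e]
    calc ‖(η z - η z') • w z + η z' • (w z - w z')‖
        ≤ ‖η z - η z'‖ * ‖w z‖ + ‖η z'‖ * ‖w z - w z'‖ := by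
          refine (norm_add_le _ _).trans (add_le_add ?_ ?_) <;> rw [norm_smul]
      _ ≤ p₁ * ‖z - z'‖ ^ s * q₀ + p₀ * (q₁ * ‖z - z'‖ ^ s) :=
          add_le_add (mul_le_mul (hp₁ z z') (hq₀ z) (norm_nonneg _)
            ((norm_nonneg _).trans (hp₁ z z'))) (mul_le_mul (hp₀ z') (hq₁ z z') (norm_nonneg _) hp)
      _ = (p₁ * q₀ + p₀ * q₁) * ‖z - z'‖ ^ s := by ring

end Smul

section Linear

/-- **The pointwise conjugation identity.** If `v = Θ ṽ` solves `∂ₓ v + A ∂_y v = f` at `z`,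
`A z ∘ Θ z = Θ z ∘ i` and `Θi z ∘ Θ z = 1`, then
`∂ₓ ṽ + i ∂_y ṽ = Θi (f - (∂ₓΘ) ṽ - A ((∂_yΘ) ṽ))` at `z`. [folklore] -/
theorem dbar_frame_identity {Θ : ℂ → (ℂ × ℂ) →L[ℝ] E4} {Θi : ℂ → E4 →L[ℝ] (ℂ × ℂ)}
    {A : ℂ → E4 →L[ℝ] E4} {w : ℂ → ℂ × ℂ} {f : ℂ → E4} {z : ℂ}
    (hΘ : DifferentiableAt ℝ Θ z) (hw : DifferentiableAt ℝ w z)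
    (hinv₁ : (Θi z).comp (Θ z) = ContinuousLinearMap.id ℝ _)
    (hAΘ : ∀ y, A z (Θ z y) = Θ z (I • y))
    (heq : fderiv ℝ (fun x => Θ x (w x)) z 1 + A z (fderiv ℝ (fun x => Θ x (w x)) z I) = f z) :
    fderiv ℝ w z 1 + I • fderiv ℝ w z I =
      Θi z (f z - fderiv ℝ Θ z 1 (w z) - A z (fderiv ℝ Θ z I (w z))) := by
  rw [fderiv_clm_apply hΘ hw] at heq
  simp only [add_apply, ContinuousLinearMap.coe_comp, Function.comp_apply,
    ContinuousLinearMap.flip_apply, map_add, hAΘ] at heq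
  have hid : ∀ y, Θi z (Θ z y) = y := fun y => by
    have := DFunLike.congr_fun hinv₁ y
    simpa using this
  have key : Θ z (fderiv ℝ w z 1 + I • fderiv ℝ w z I) =
      f z - fderiv ℝ Θ z 1 (w z) - A z (fderiv ℝ Θ z I (w z)) := by
    rw [map_add, ← heq]
    abel
  rw [← key, hid]

/-- **`∂̄` of a product with a real cutoff**: for `φ = η • w`,
`∂̄ φ = η ∂̄ w + ½ ((∂ₓη) w + i (∂_yη) w)`. [folklore] -/
theorem dbarAlong_smul {η : ℂ → ℝ} {w : ℂ → ℂ × ℂ} {z : ℂ} (hη : DifferentiableAt ℝ η z)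
    (hw : DifferentiableAt ℝ w z) :
    dbarAlong 1 (fun x => η x • w x) z = η z • dbarAlong 1 w z +
      (2 : ℂ)⁻¹ • (fderiv ℝ η z 1 • w z + I • (fderiv ℝ η z I • w z)) := by
  rw [dbarAlong_one, dbarAlong_one, fderiv_fun_smul hη hw]
  simp only [add_apply, smul_apply,
    ContinuousLinearMap.smulRight_apply, smul_add, smul_comm (η z) I, smul_comm (η z) (2 : ℂ)⁻¹]
  abel

/-- **Back from the frame**: bounds for `Dv = Θ ∘ Dw + (DΘ)ᵀ w` on a set `S` from bounds for
`Θ`, `DΘ`, `w` everywhere and for `Dw` on `S`. [folklore] -/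
theorem fderiv_frame_bounds {Θ : ℂ → (ℂ × ℂ) →L[ℝ] E4} {w : ℂ → ℂ × ℂ} {v : ℂ → E4} {S : Set ℂ}
    {N M D s : ℝ} (hN0 : 0 ≤ N) (_hM : 0 ≤ M) (_hD : 0 ≤ D)
    (hΘ₀ : ∀ z, ‖Θ z‖ ≤ N) (hΘ₁ : ∀ z, ‖fderiv ℝ Θ z‖ ≤ N)
    (hΘ₂ : ∀ z z', ‖fderiv ℝ Θ z - fderiv ℝ Θ z'‖ ≤ N * ‖z - z'‖ ^ s)
    (hΘH : ∀ z z', ‖Θ z - Θ z'‖ ≤ 3 * N * ‖z - z'‖ ^ s)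
    (hw₀ : ∀ z, ‖w z‖ ≤ N * M) (hw₁ : ∀ z z', ‖w z - w z'‖ ≤ 4 * N * M * ‖z - z'‖ ^ s)
    (hD₀ : ∀ z ∈ S, ‖fderiv ℝ w z‖ ≤ D * M)
    (hD₁ : ∀ z ∈ S, ∀ z' ∈ S, ‖fderiv ℝ w z - fderiv ℝ w z'‖ ≤ D * M * ‖z - z'‖ ^ s)
    (hvD : ∀ z, fderiv ℝ v z = (Θ z).comp (fderiv ℝ w z) + (fderiv ℝ Θ z).flip (w z)) :
    (∀ z ∈ S, ‖fderiv ℝ v z‖ ≤ (N * D + N ^ 2) * M) ∧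
      ∀ z ∈ S, ∀ z' ∈ S,
        ‖fderiv ℝ v z - fderiv ℝ v z'‖ ≤ (4 * N * D + 5 * N ^ 2) * M * ‖z - z'‖ ^ s := by
  refine ⟨fun z hz => ?_, fun z hz z' hz' => ?_⟩
  · rw [hvD z]
    calc ‖(Θ z).comp (fderiv ℝ w z) + (fderiv ℝ Θ z).flip (w z)‖
        ≤ ‖Θ z‖ * ‖fderiv ℝ w z‖ + ‖(fderiv ℝ Θ z).flip‖ * ‖w z‖ :=
          (norm_add_le _ _).trans (add_le_add (ContinuousLinearMap.opNorm_comp_le _ _)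
            (ContinuousLinearMap.le_opNorm _ _))
      _ ≤ N * (D * M) + N * (N * M) := by
          rw [ContinuousLinearMap.opNorm_flip]
          exact add_le_add (mul_le_mul (hΘ₀ z) (hD₀ z hz) (norm_nonneg _) hN0)
            (mul_le_mul (hΘ₁ z) (hw₀ z) (norm_nonneg _) hN0)
      _ = (N * D + N ^ 2) * M := by ring
  · rw [hvD z, hvD z']
    have hd0 : 0 ≤ ‖z - z'‖ ^ s := Real.rpow_nonneg (norm_nonneg _) _
    have e1 : (Θ z).comp (fderiv ℝ w z) + (fderiv ℝ Θ z).flip (w z) -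
        ((Θ z').comp (fderiv ℝ w z') + (fderiv ℝ Θ z').flip (w z')) =
        ((Θ z).comp (fderiv ℝ w z) - (Θ z').comp (fderiv ℝ w z')) +
          ((fderiv ℝ Θ z).flip (w z) - (fderiv ℝ Θ z').flip (w z')) := by abel
    have e2 : ‖(Θ z).comp (fderiv ℝ w z) - (Θ z').comp (fderiv ℝ w z')‖ ≤
        ‖Θ z - Θ z'‖ * ‖fderiv ℝ w z‖ + ‖Θ z'‖ * ‖fderiv ℝ w z - fderiv ℝ w z'‖ := by
      have : (Θ z).comp (fderiv ℝ w z) - (Θ z').comp (fderiv ℝ w z') =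
          (Θ z - Θ z').comp (fderiv ℝ w z) + (Θ z').comp (fderiv ℝ w z - fderiv ℝ w z') := by
        rw [ContinuousLinearMap.sub_comp, ContinuousLinearMap.comp_sub]
        abel
      rw [this]
      exact (norm_add_le _ _).trans (add_le_add (ContinuousLinearMap.opNorm_comp_le _ _)
        (ContinuousLinearMap.opNorm_comp_le _ _))
    have e3 : ‖(fderiv ℝ Θ z).flip (w z) - (fderiv ℝ Θ z').flip (w z')‖ ≤
        ‖fderiv ℝ Θ z - fderiv ℝ Θ z'‖ * ‖w z‖ + ‖fderiv ℝ Θ z'‖ * ‖w z - w z'‖ := by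
      refine ContinuousLinearMap.opNorm_le_bound _ (by positivity) fun e => ?_
      have hfe : ((fderiv ℝ Θ z).flip (w z) - (fderiv ℝ Θ z').flip (w z')) e =
          fderiv ℝ Θ z e (w z) - fderiv ℝ Θ z' e (w z') := by
        simp only [sub_apply, ContinuousLinearMap.flip_apply]
      have b1 : ‖fderiv ℝ Θ z e - fderiv ℝ Θ z' e‖ ≤ ‖fderiv ℝ Θ z - fderiv ℝ Θ z'‖ * ‖e‖ := by
        change ‖(fderiv ℝ Θ z - fderiv ℝ Θ z') e‖ ≤ _
        exact (fderiv ℝ Θ z - fderiv ℝ Θ z').le_opNorm e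
      have b2 : ‖fderiv ℝ Θ z' e‖ ≤ ‖fderiv ℝ Θ z'‖ * ‖e‖ := (fderiv ℝ Θ z').le_opNorm e
      rw [hfe]
      calc ‖fderiv ℝ Θ z e (w z) - fderiv ℝ Θ z' e (w z')‖
          ≤ ‖fderiv ℝ Θ z e - fderiv ℝ Θ z' e‖ * ‖w z‖ + ‖fderiv ℝ Θ z' e‖ * ‖w z - w z'‖ :=
            norm_apply_sub_apply_le _ _ _ _
        _ ≤ ‖fderiv ℝ Θ z - fderiv ℝ Θ z'‖ * ‖e‖ * ‖w z‖ + ‖fderiv ℝ Θ z'‖ * ‖e‖ * ‖w z - w z'‖ := by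
            gcongr
        _ = (‖fderiv ℝ Θ z - fderiv ℝ Θ z'‖ * ‖w z‖ + ‖fderiv ℝ Θ z'‖ * ‖w z - w z'‖) * ‖e‖ := by
            ring
    rw [e1]
    calc ‖((Θ z).comp (fderiv ℝ w z) - (Θ z').comp (fderiv ℝ w z')) +
          ((fderiv ℝ Θ z).flip (w z) - (fderiv ℝ Θ z').flip (w z'))‖
        ≤ (‖Θ z - Θ z'‖ * ‖fderiv ℝ w z‖ + ‖Θ z'‖ * ‖fderiv ℝ w z - fderiv ℝ w z'‖) +
          (‖fderiv ℝ Θ z - fderiv ℝ Θ z'‖ * ‖w z‖ + ‖fderiv ℝ Θ z'‖ * ‖w z - w z'‖) :=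
          (norm_add_le _ _).trans (add_le_add e2 e3)
      _ ≤ (3 * N * ‖z - z'‖ ^ s * (D * M) + N * (D * M * ‖z - z'‖ ^ s)) +
          (N * ‖z - z'‖ ^ s * (N * M) + N * (4 * N * M * ‖z - z'‖ ^ s)) := by
          gcongr
          · exact hΘH z z'
          · exact hD₀ z hz
          · exact hΘ₀ z'
          · exact hD₁ z hz z' hz'
          · exact hΘ₂ z z'
          · exact hw₀ z
          · exact hΘ₁ z'
          · exact hw₁ z z'
      _ = (4 * N * D + 5 * N ^ 2) * M * ‖z - z'‖ ^ s := by ring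

set_option maxHeartbeats 400000 in
/-- **The linear `C^{1,r}` estimate (elliptic regularity for a Cauchy–Riemann system conjugate to
`∂̄`).** Let `0 < r < 1`, assume the `C^{1,r}` estimate for the Cauchy transform on `ℂ²`-valued
densities (`CauchyTransformHolderApriori (ℂ × ℂ) r`), and let `Θ`, `Θi`, `A` be a `C¹` frame
`ℂ² → ℝ⁴`, its inverse and coefficients with the bounds `N ≥ 1` below, `Θi Θ = 1 = Θ Θi`, and
`A Θ = Θ ∘ i` on the disc `B(z₀, ρ)`. Then there is `K ≥ 0` such that every `C¹` map `v : ℂ → ℝ⁴`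
with `∂ₓ v + A ∂_y v = f` on `B(z₀, ρ)`, `‖v‖, [v]_r, ‖f‖, [f]_r ≤ M`, satisfies `‖Dv‖ ≤ K M` and
`‖Dv z - Dv z'‖ ≤ K M ‖z - z'‖ ^ r` on `B(z₀, ρ/2)`. [cite: McDuffSalamon2012, Thm B.4.1] -/
theorem holder_fderiv_of_linearCR {r : ℝ≥0} (hr : 0 < r) (hr1 : r < 1)
    (hT : CauchyTransformHolderApriori (ℂ × ℂ) r) {z₀ : ℂ} {ρ N : ℝ} (hρ : 0 < ρ) (hN : 1 ≤ N)
    {Θ : ℂ → (ℂ × ℂ) →L[ℝ] E4} {Θi : ℂ → E4 →L[ℝ] (ℂ × ℂ)} {A : ℂ → E4 →L[ℝ] E4}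
    (hΘ : ContDiff ℝ 1 Θ) (hΘ₀ : ∀ z, ‖Θ z‖ ≤ N) (hΘ₁ : ∀ z, ‖fderiv ℝ Θ z‖ ≤ N)
    (hΘ₂ : ∀ z z', ‖fderiv ℝ Θ z - fderiv ℝ Θ z'‖ ≤ N * ‖z - z'‖ ^ (r : ℝ))
    (hΘi : ContDiff ℝ 1 Θi) (hΘi₀ : ∀ z, ‖Θi z‖ ≤ N) (hΘi₁ : ∀ z, ‖fderiv ℝ Θi z‖ ≤ N)
    (hA₀ : ∀ z, ‖A z‖ ≤ N) (hA₁ : ∀ z z', ‖A z - A z'‖ ≤ N * ‖z - z'‖ ^ (r : ℝ))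
    (hinv₁ : ∀ z, (Θi z).comp (Θ z) = ContinuousLinearMap.id ℝ _)
    (hinv₂ : ∀ z, (Θ z).comp (Θi z) = ContinuousLinearMap.id ℝ _)
    (hAΘ : ∀ z ∈ ball z₀ ρ, ∀ y, A z (Θ z y) = Θ z (I • y)) :
    ∃ K : ℝ, 0 ≤ K ∧ ∀ (v f : ℂ → E4) (M : ℝ), 0 ≤ M → ContDiff ℝ 1 v →
      (∀ z ∈ ball z₀ ρ, fderiv ℝ v z 1 + A z (fderiv ℝ v z I) = f z) →
      (∀ z, ‖v z‖ ≤ M) → (∀ z z', ‖v z - v z'‖ ≤ M * ‖z - z'‖ ^ (r : ℝ)) →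
      (∀ z, ‖f z‖ ≤ M) → (∀ z z', ‖f z - f z'‖ ≤ M * ‖z - z'‖ ^ (r : ℝ)) →
      (∀ z ∈ ball z₀ (ρ / 2), ‖fderiv ℝ v z‖ ≤ K * M) ∧
      ∀ z ∈ ball z₀ (ρ / 2), ∀ z' ∈ ball z₀ (ρ / 2),
        ‖fderiv ℝ v z - fderiv ℝ v z'‖ ≤ K * M * ‖z - z'‖ ^ (r : ℝ) := by
  -- exponent and structural constants
  have hs0 : 0 < (r : ℝ) := hr
  have hs1 : (r : ℝ) ≤ 1 := le_of_lt hr1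
  have hN0 : 0 ≤ N := zero_le_one.trans hN
  have hΘd : Differentiable ℝ Θ := hΘ.differentiable (by simp)
  have hΘid : Differentiable ℝ Θi := hΘi.differentiable (by simp)
  have hΘH : ∀ z z', ‖Θ z - Θ z'‖ ≤ (2 * N + N) * ‖z - z'‖ ^ (r : ℝ) :=
    holder_of_norm_fderiv_le hΘd hs0.le hs1 hΘ₀ hΘ₁
  have hΘiH : ∀ z z', ‖Θi z - Θi z'‖ ≤ (2 * N + N) * ‖z - z'‖ ^ (r : ℝ) :=
    holder_of_norm_fderiv_le hΘid hs0.le hs1 hΘi₀ hΘi₁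
  have hid₁ : ∀ z y, Θi z (Θ z y) = y := fun z y => by
    have := DFunLike.congr_fun (hinv₁ z) y
    simpa using this
  have hid₂ : ∀ z x, Θ z (Θi z x) = x := fun z x => by
    have := DFunLike.congr_fun (hinv₂ z) x
    simpa using this
  -- the partial derivatives of the frame
  have hP₀ : ∀ e : ℂ, ‖e‖ = 1 → ∀ z, ‖fderiv ℝ Θ z e‖ ≤ N := fun e he z =>
    ((fderiv ℝ Θ z).le_opNorm e).trans (by rw [he, mul_one]; exact hΘ₁ z)
  have hP₁ : ∀ e : ℂ, ‖e‖ = 1 → ∀ z z',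
      ‖fderiv ℝ Θ z e - fderiv ℝ Θ z' e‖ ≤ N * ‖z - z'‖ ^ (r : ℝ) := fun e he z z' => by
    change ‖(fderiv ℝ Θ z - fderiv ℝ Θ z') e‖ ≤ _
    exact ((fderiv ℝ Θ z - fderiv ℝ Θ z').le_opNorm e).trans (by rw [he, mul_one]; exact hΘ₂ z z')
  -- the cutoff
  have hKU : closedBall z₀ (ρ / 2) ⊆ ball z₀ (3 * ρ / 4) := closedBall_subset_ball (by linarith)
  obtain ⟨η, hη, hηc, hηU, hη1, hη01⟩ :=
    exists_contDiff_one_nhdsSet_of_isCompact (isCompact_closedBall z₀ (ρ / 2)) isOpen_ball hKU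
  obtain ⟨c, hc, hc₀, hc₁, hc₂, hc₃⟩ := exists_cutoff_holder_bounds hη hηc hs0.le hs1
  have hηd : Differentiable ℝ η := hη.differentiable (by simp)
  have hQ₀ : ∀ e : ℂ, ‖e‖ = 1 → ∀ z, ‖fderiv ℝ η z e‖ ≤ c := fun e he z =>
    ((fderiv ℝ η z).le_opNorm e).trans (by rw [he, mul_one]; exact hc₂ z)
  have hQ₁ : ∀ e : ℂ, ‖e‖ = 1 → ∀ z z',
      ‖fderiv ℝ η z e - fderiv ℝ η z' e‖ ≤ c * ‖z - z'‖ ^ (r : ℝ) := fun e he z z' => by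
    change ‖(fderiv ℝ η z - fderiv ℝ η z') e‖ ≤ _
    exact ((fderiv ℝ η z - fderiv ℝ η z').le_opNorm e).trans (by rw [he, mul_one]; exact hc₃ z z')
  -- the Cauchy transform estimate at radius `‖z₀‖ + ρ`
  obtain ⟨C, hC0, hC⟩ := cauchyTransform_holder_of_apriori (ℂ × ℂ) hr hr1 hT (‖z₀‖ + ρ)
    (by positivity)
  -- the constant
  refine ⟨(20 * c * C * N ^ 5 + N ^ 2) + (80 * c * C * N ^ 5 + 5 * N ^ 2), by positivity,
    fun v f M hM hv heq hv₀ hv₁ hf₀ hf₁ => ?_⟩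
  have hI : ‖(I : ℂ)‖ = 1 := by simp
  have h1 : ‖(1 : ℂ)‖ = 1 := by simp
  have hN1 : N ≤ N ^ 2 := by nlinarith
  have hN2 : N ^ 2 ≤ N ^ 3 := by nlinarith
  have hN3 : N ^ 3 ≤ N ^ 4 := by nlinarith
  have hN4 : N ^ 4 ≤ N ^ 5 := by nlinarith
  have hd0 : ∀ z z' : ℂ, 0 ≤ ‖z - z'‖ ^ (r : ℝ) := fun z z' => Real.rpow_nonneg (norm_nonneg _) _
  -- the conjugated unknown
  set w : ℂ → ℂ × ℂ := fun z => Θi z (v z) with hw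
  have hwd : ContDiff ℝ 1 w := hΘi.clm_apply hv
  have hwD : Differentiable ℝ w := hwd.differentiable (by simp)
  have hvw : (fun z => Θ z (w z)) = v := funext fun z => hid₂ z (v z)
  have hvD : ∀ z, fderiv ℝ v z = (Θ z).comp (fderiv ℝ w z) + (fderiv ℝ Θ z).flip (w z) := by
    intro z
    rw [← hvw]
    exact fderiv_clm_apply (hΘd z) (hwD z)
  -- bounds for `w`
  obtain ⟨hw₀, hw₁⟩ := holder_bound_clm_apply hΘi₀ hΘiH hv₀ hv₁
  replace hw₁ : ∀ z z', ‖w z - w z'‖ ≤ 4 * N * M * ‖z - z'‖ ^ (r : ℝ) := fun z z' =>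
    (hw₁ z z').trans_eq (by ring)
  -- the density `Q = f - (∂ₓΘ) w - A ((∂_yΘ) w)` and its bounds
  set Q : ℂ → E4 := fun z => f z - fderiv ℝ Θ z 1 (w z) - A z (fderiv ℝ Θ z I (w z)) with hQ
  obtain ⟨h1₀, h1₁⟩ := holder_bound_clm_apply (hP₀ 1 h1) (hP₁ 1 h1) hw₀ hw₁
  obtain ⟨h2₀, h2₁⟩ := holder_bound_clm_apply (hP₀ I hI) (hP₁ I hI) hw₀ hw₁
  obtain ⟨h3₀, h3₁⟩ := holder_bound_clm_apply hA₀ hA₁ h2₀ h2₁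
  obtain ⟨h4₀, h4₁⟩ := holder_bound_sub hf₀ hf₁ h1₀ h1₁
  obtain ⟨h5₀, h5₁⟩ := holder_bound_sub h4₀ h4₁ h3₀ h3₁
  have hQb₀ : ∀ z, ‖Q z‖ ≤ 3 * N ^ 3 * M := fun z => (h5₀ z).trans (by nlinarith)
  have hQb₁ : ∀ z z', ‖Q z - Q z'‖ ≤ 12 * N ^ 3 * M * ‖z - z'‖ ^ (r : ℝ) := fun z z' =>
    (h5₁ z z').trans (mul_le_mul_of_nonneg_right (by nlinarith) (hd0 z z'))
  obtain ⟨h6₀, h6₁⟩ := holder_bound_clm_apply hΘi₀ hΘiH hQb₀ hQb₁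
  obtain ⟨h7₀, h7₁⟩ := holder_bound_const_smul (2 : ℂ)⁻¹ h6₀ h6₁
  -- the identity `2 ∂̄ w = Θi Q` on the disc
  have hdbar : ∀ z ∈ ball z₀ ρ, dbarAlong 1 w z = (2 : ℂ)⁻¹ • Θi z (Q z) := by
    intro z hz
    rw [dbarAlong_one, hQ]
    congr 1
    refine dbar_frame_identity (hΘd z) (hwD z) (hinv₁ z) (hAΘ z hz) ?_
    rw [hvw]
    exact heq z hz
  -- the cut-off unknown and its `∂̄`
  set φ : ℂ → ℂ × ℂ := fun z => η z • w z with hφ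
  have hφd : ContDiff ℝ 1 φ := (hη.of_le (by exact_mod_cast le_top)).smul hwd
  have hφc : HasCompactSupport φ := hηc.smul_right
  have hφt : tsupport φ ⊆ ball z₀ (3 * ρ / 4) := (tsupport_smul_subset_left η w).trans hηU
  set g : ℂ → ℂ × ℂ := dbarAlong 1 φ with hg
  set G : ℂ → ℂ × ℂ := fun z => η z • ((2 : ℂ)⁻¹ • Θi z (Q z)) +
    (2 : ℂ)⁻¹ • (fderiv ℝ η z 1 • w z + I • (fderiv ℝ η z I • w z)) with hG
  have hgG : ∀ z, g z = G z := by
    intro z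
    have e : g z = η z • dbarAlong 1 w z +
        (2 : ℂ)⁻¹ • (fderiv ℝ η z 1 • w z + I • (fderiv ℝ η z I • w z)) :=
      dbarAlong_smul (hηd z) (hwD z)
    rw [e, hG]
    by_cases hz : z ∈ ball z₀ ρ
    · rw [hdbar z hz]
    · have hz' : z ∉ tsupport η := fun h => hz ((hηU.trans (ball_subset_ball (by linarith))) h)
      have h0 : η z = 0 := image_eq_zero_of_notMem_tsupport hz'
      simp only [h0, zero_smul]
  -- bounds for `g`
  obtain ⟨h8₀, h8₁⟩ := holder_bound_smul hc₀ hc₁ h7₀ h7₁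
  obtain ⟨h9₀, h9₁⟩ := holder_bound_smul (hQ₀ 1 h1) (hQ₁ 1 h1) hw₀ hw₁
  obtain ⟨h10₀, h10₁⟩ := holder_bound_smul (hQ₀ I hI) (hQ₁ I hI) hw₀ hw₁
  obtain ⟨h11₀, h11₁⟩ := holder_bound_const_smul I h10₀ h10₁
  obtain ⟨h12₀, h12₁⟩ := holder_bound_add h9₀ h9₁ h11₀ h11₁
  obtain ⟨h13₀, h13₁⟩ := holder_bound_const_smul (2 : ℂ)⁻¹ h12₀ h12₁
  obtain ⟨h14₀, h14₁⟩ := holder_bound_add h8₀ h8₁ h13₀ h13₁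
  have h2inv : ‖(2 : ℂ)⁻¹‖ = 2⁻¹ := by simp
  rw [h2inv, hI] at h14₀ h14₁
  have hg₀ : ∀ z, ‖g z‖ ≤ 3 * c * N ^ 4 * M := fun z => by
    rw [hgG z]
    exact (h14₀ z).trans (by nlinarith [mul_nonneg hc hM, mul_nonneg (mul_nonneg hc hM) hN0])
  have hg₁ : ∀ z z', ‖g z - g z'‖ ≤ 17 * c * N ^ 4 * M * ‖z - z'‖ ^ (r : ℝ) := fun z z' => by
    rw [hgG z, hgG z']
    exact (h14₁ z z').trans (mul_le_mul_of_nonneg_right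
      (by nlinarith [mul_nonneg hc hM, mul_nonneg (mul_nonneg hc hM) hN0]) (hd0 z z'))
  -- `g` is a continuous density supported in the disc `‖z‖ < ‖z₀‖ + ρ`
  have hgc : Continuous g := by
    have h := hφd.continuous_fderiv (by simp)
    rw [hg, show dbarAlong 1 φ = fun z => (2 : ℂ)⁻¹ • (fderiv ℝ φ z 1 + I • fderiv ℝ φ z I) from
      funext fun z => dbarAlong_one φ z]
    exact ((h.clm_apply continuous_const).add
      ((h.clm_apply continuous_const).const_smul (I : ℂ))).const_smul ((2 : ℂ)⁻¹)
  have hgρ : ∀ z, ‖z₀‖ + ρ ≤ ‖z‖ → g z = 0 := by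
    intro z hz
    have hz' : z ∉ tsupport φ := fun h => by
      have h' := mem_ball_iff_norm.1 (hφt h)
      have : ‖z‖ ≤ ‖z - z₀‖ + ‖z₀‖ := norm_le_norm_sub_add z z₀
      linarith
    have h0 : fderiv ℝ φ z = 0 := notMem_support.1 fun h => hz' (support_fderiv_subset ℝ h)
    rw [hg, dbarAlong_one, h0]
    simp
  -- Cauchy–Pompeiu: `φ` is the Cauchy transform of `g`, and the Cauchy transform estimate
  have hTφ : cauchyTransformAlong (1 : ℂ) g = φ :=
    funext fun z => cauchyTransformAlong_dbarAlong_self hφd hφc one_ne_zero z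
  obtain ⟨-, -, -, hD₀, hD₁⟩ := hC g hgc hgρ (3 * c * N ^ 4 * M) (17 * c * N ^ 4 * M)
    (by positivity) (by positivity) hg₀ hg₁
  rw [hTφ] at hD₀ hD₁
  -- on the half disc `φ = w`
  have hφw : ∀ z ∈ ball z₀ (ρ / 2), fderiv ℝ φ z = fderiv ℝ w z := by
    intro z hz
    refine Filter.EventuallyEq.fderiv_eq ?_
    filter_upwards [(eventually_nhdsSet_iff_forall.1 hη1) z (ball_subset_closedBall hz)] with x hx
    simp [hφ, hx]
  have hDw₀ : ∀ z ∈ ball z₀ (ρ / 2), ‖fderiv ℝ w z‖ ≤ 20 * c * C * N ^ 4 * M := fun z hz => by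
    rw [← hφw z hz]
    exact (hD₀ z).trans_eq (by ring)
  have hDw₁ : ∀ z ∈ ball z₀ (ρ / 2), ∀ z' ∈ ball z₀ (ρ / 2),
      ‖fderiv ℝ w z - fderiv ℝ w z'‖ ≤ 20 * c * C * N ^ 4 * M * ‖z - z'‖ ^ (r : ℝ) :=
    fun z hz z' hz' => by
    rw [← hφw z hz, ← hφw z' hz']
    exact (hD₁ z z').trans_eq (by ring)
  -- back to `v = Θ w`
  replace hΘH : ∀ z z', ‖Θ z - Θ z'‖ ≤ 3 * N * ‖z - z'‖ ^ (r : ℝ) := fun z z' =>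
    (hΘH z z').trans_eq (by ring)
  have hD : 0 ≤ 20 * c * C * N ^ 4 := by positivity
  obtain ⟨hE₀, hE₁⟩ := fderiv_frame_bounds hN0 hM hD hΘ₀ hΘ₁ hΘ₂ hΘH hw₀ hw₁ hDw₀ hDw₁ hvD
  have hK₁ : N * (20 * c * C * N ^ 4) + N ^ 2 ≤
      (20 * c * C * N ^ 5 + N ^ 2) + (80 * c * C * N ^ 5 + 5 * N ^ 2) := by
    nlinarith [mul_nonneg (mul_nonneg hc hC0) (pow_nonneg hN0 5)]
  have hK₂ : 4 * N * (20 * c * C * N ^ 4) + 5 * N ^ 2 ≤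
      (20 * c * C * N ^ 5 + N ^ 2) + (80 * c * C * N ^ 5 + 5 * N ^ 2) := by
    nlinarith [mul_nonneg (mul_nonneg hc hC0) (pow_nonneg hN0 5)]
  exact ⟨fun z hz => (hE₀ z hz).trans (mul_le_mul_of_nonneg_right hK₁ hM),
    fun z hz z' hz' => (hE₁ z hz z' hz').trans (mul_le_mul_of_nonneg_right
      (mul_le_mul_of_nonneg_right hK₂ hM) (hd0 z z'))⟩

end Linear

end Literature.Geometry.Symplectic
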